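import Literature.Computability.QuantumComplexity.GuidedPauliHamiltonian
import Literature.Computability.Cryptography.LatticeOWF
import HarnessLib

/-!
# Constant-precision guided local Hamiltonian is in promise-BPP (Le Gall, ESA 2025)

The classical half of the guided-local-Hamiltonian dichotomy, in the strong form of Le Gall
[Gall2024] (ESA 2025, LIPIcs 351:73; arXiv:2410.21833).  The paper's main theorem is an
ESTIMATION statement under sample-and-query access:

> **Theorem 3.** For any `s ≥ 2` and any `ε, χ ∈ (0,1] ∩ ℝ[poly(n)]`, the problem `EV(s, χ, ε)` —
> input: a normal matrix `A ∈ ℂ^{N×N}` with an `(s, κ)`-decomposition, and sample-and-query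
> access to a state `|ψ⟩` whose overlap with the eigenvectors of energy `≤ E(A) + (ε/2)κ` is
> `≥ χ`; output: `E*` with `|E* − E(A)| ≤ εκ` with probability `≥ 1 − 1/exp(n)` — can be solved
> classically in time `O*(s^{c' log(1/χ)/ε})` for a universal constant `c'`, and space `O*(1/ε²)`.
> **Theorem 4.** For a `k`-local `H = Σᵢ Hᵢ` on `n` qubits and `κ = Σᵢ ‖Hᵢ‖`: time
> `poly(χ^{-k/ε}, n)` (Theorem 3 with `s = 2^k`).

and its printed complexity-theoretic consequence [Gall2024, §1.3, box `GLH(ε, χ)` and the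
sentence following it]:

> `GLH(ε, χ)` — input: an `O(1)`-local Hamiltonian `H = Σᵢ Hᵢ` as in (1) (`m = poly(n)` Hermitian
> terms on `≤ k` qubits each, entries in `ℂ[poly(n)]`); the description of a `poly(n)`-size
> circuit implementing (sample-and-query) access to a state `|ψ⟩` with overlap at least `χ` with
> the ground state of `H`; two numbers `a, b ∈ [0,1]` with `b − a > ε`.  Promise: (i) `E(H) ≤ a`
> or (ii) `E(H) > b`.  Goal: decide which.  "… for constant `ε`, the inclusion `GLH(ε, χ) ∈ BPP`
> holds for `χ = 1/poly(n)` as well."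

A faithful Lean statement of Theorem 3 itself needs an oracle (sample-and-query) model of
randomised computation, which the tree does not have.  What the tree DOES have is the explicit
instance format of `GuidedPauliHamiltonian.lean` — Hamiltonians given as weighted Pauli term
lists, guides given as explicit signed subset lists — and `PromiseBPP'` (textbook promise-BPP,
`Promise.lean`).  This file therefore vendors the PRINTED CONSEQUENCE above, SPECIALISED to that
format, as ONE named fact `LeGall2025_guidedLH_constPrecision_BPP`; the specialisation only
discards instances (it is weaker than the printed sentence), as follows:

* *Hamiltonian.*  A term list with INTEGER weights (`q_t = 0`, predicate `IsLocalIntegral`) and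
  at most `k` non-identity letters per Pauli word is literally "`H = Σ_t H_t`, `H_t = p_t · P_t`
  Hermitian, acting non-trivially on `≤ k` qubits, entries in `ℤ·{±1, ±i} ⊂ ℂ[poly(n)]`", with
  `‖H_t‖ = |p_t|` known, so `Σ_t ‖H_t‖` is the format's Pauli 1-norm `Λ` (`pauliOneNorm`).  The
  `ℤ[√2]`-weights of the general format are EXCLUDED here (irrational entries are not in the
  printed input model `ℂ[poly(n)]`); `-- TODO(general form)` below.
* *Normalisation.*  The paper measures precision relative to `Σᵢ ‖Hᵢ‖` (§1.1: "`Ê` is an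
  `ε`-approximation of `E(H)` if `|Ê − E(H)| ≤ ε Σᵢ ‖Hᵢ‖`") and derives the `GLH(ε, χ) ∈ BPP`
  sentence from Theorem 4 under that convention (§1.4: "we assume `κ = 1` (the general case
  can be reduced to this case by renormalizing the matrix)").  Integer weights cannot be
  renormalised inside the format, so — exactly as in delta (i) of `GuidedPauliHamiltonian.lean`
  — thresholds are read in units of `Λ`: `a = α/(D+1)`, `b = β/(D+1)`, YES `E(H) ≤ aΛ`, NO
  `E(H) > bΛ`, with `a, b ∈ [0,1]` (`0 ≤ α`, `β ≤ D+1`) and `b − a > ε` (strict, as printed).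
* *Guide.*  An explicit signed subset list `u = Σ (−1)^s e_x` (the format's `signedSubsetState`,
  unnormalised) is a `poly`-size description from which sample-and-query access to `u/‖u‖` is
  implemented in time polynomial in the list length (compute the `≤ |list|` non-zero amplitudes;
  sample proportionally to their squares) — the special case "subset states" that
  [GharibianLegall2022, §1.2] calls semi-classical ("sampling-access to `u` can trivially be
  implemented").  "Overlap at least `χ` with the ground state" is read as `‖Π u‖ ≥ χ‖u‖` for the
  ground-space projector `Π`, stated through ONE eigenvector `v` of the least eigenvalue with
  `χ² ‖u‖² ‖v‖² ≤ |⟨u, v⟩|²` (equivalent: take `v = Πu`; conversely Cauchy–Schwarz inside the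
  ground space); the promise is imposed on BOTH sides, as printed (contrast delta (iv) of the
  format's own problem, whose NO side carries no guide promise — that problem is NOT asserted to
  be in `PromiseBPP'` here; deriving it needs the interval test of [Gall2024, §5.1], a proof
  obligation for `Summits/…/Theorems`, not a citation).
* *Parameters.*  "constant `ε`" ↦ `ε = 1/(K+1)`, `K : ℕ`; "`χ = 1/poly(n)`" ↦ `χ(n) = 1/(n^c + c)`.
  The printed side conditions `ε, χ ∈ ℝ[poly(n)]` (dyadic rationals of polynomial length) are met
  by passing to the sub-problem with `ε' = 2^{-⌈log₂(K+1)⌉} ≤ ε` and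
  `χ'(n) = 2^{-⌈log₂(n^c+c)⌉} ∈ [χ(n)/2, χ(n)]`: every instance below is an instance of
  `GLH(ε', χ')` with the same answer (gap `> ε ≥ ε'`, overlap `≥ χ ≥ χ'`), and promise-BPP is
  antitone in the promise (the tree's `Literature.Computability.Cryptography.mem_PromiseBPP'_of_subset`).
* *Class.*  "`∈ BPP`" for a promise problem is textbook promise-BPP, the tree's `PromiseBPP'`
  (gap `2/3` required on the promise only).

Proved here (no `sorry`): disjointness of the promise, antitonicity in `χ` / monotonicity in `k`
of the instance sets, and the corollary that the fact gives membership for every smaller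
locality and every larger overlap schedule (via the tree's antitonicity of `PromiseBPP'` in the
promise, `mem_PromiseBPP'_of_subset`, imported from `LatticeOWF.lean`).

Wanted by: cell pub-qadeq (DEQ-A28: FeMoco read through the guided-local-Hamiltonian frame —
instance-level adjudication; no claim about BQP vs BPP or the summit), work item wi-44332.
Companion hardness fact: `GuidedPauliBQPHardness.lean` (`GharibianLeGall2022_thm2`).

Addendum (2026-08-20, same cell, units deq-2 / harvest-1): a SECOND named fact
`LeGall2025_guidedPauliAnyWeight_constPrecision_BPP` — the same sentence for integer-weight Pauli
term lists of ANY weight, i.e. [Gall2024] Theorem 3 with `s = 2` (a Pauli word is `1`-sparse, so a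
term list is a `(2, Λ)`-decomposition in the sense of Def. 4) instead of Theorem 4 (`s = 2^k`) —
over the unions of the `k`-local instance sets, with the proof that it implies the first fact;
see the section "Pauli decompositions of any weight" at the end of the file.

## References

* [Gall2024] F. Le Gall, *Classical algorithms for constant approximation of the ground state
  energy of local Hamiltonians*, 33rd ESA (2025), LIPIcs 351, 73; arXiv:2410.21833 — §1.1
  (eq. (1), `ε`-approximation), §1.3 (boxes `LH(ε)`, `GLH(ε, χ)`; the `BPP` sentence), §2.1
  (`ℝ[poly(n)]`, overlap `Γ_σ`), §2.3 Def. 4 (`(s, κ)`-decomposition), §5 Thms 3–5.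
* [GharibianLegall2022] S. Gharibian, F. Le Gall, STOC 2022 / SICOMP 52(4), arXiv:2111.09079,
  §1.2 (semi-classical subset states; Thm 1: the constant-`χ` predecessor).

## Mathlib / tree search

`lean search 'guidedPauli|PromiseBPP.*subset|termLocality'` (2026-08-19): the instance format
and `PromiseBPP'` exist (reused); `mem_PromiseBPP'_of_subset` is landed in
`Literature/Computability/Cryptography/LatticeOWF.lean` and is imported and reused (the gate's
dedup check pointed there); no locality predicate and no classical-side fact for the guided
problem anywhere in the tree.
-/

noncomputable section

namespace Literature.Computability.QuantumComplexity

open Literature.Computability.Complexity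

variable {n : ℕ}

/-! ### Locality, integrality, ground-state overlap -/

/-- The locality of a weighted Pauli term: the number of qubits on which its Pauli word is not
the identity. [cite: Gall2024, §2.3 (k-local terms)] -/
def termLocality (t : GuidedPauliTerm n) : ℕ :=
  (Finset.univ.filter fun i => termString t i ≠ Pauli.I).card

/-- `IsLocalIntegral k terms`: every term is `k`-local and has an INTEGER weight (`q_t = 0`, so
`p_t + q_t√2 = p_t ∈ ℤ`): the term list is a `k`-local Hamiltonian `H = Σ_t p_t P_t` "as in (1)"
with entries in `ℂ[poly(n)]`. [cite: Gall2024, §2.3 (description of local Hamiltonians)] -/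
def IsLocalIntegral (k : ℕ) (terms : List (GuidedPauliTerm n)) : Prop :=
  ∀ t ∈ terms, termLocality t ≤ k ∧ t.1.2 = 0

/-- `IsGroundPair terms l v`: `(l, v)` is an eigenpair of `H = guidedPauliHamiltonian terms` at
the LEAST eigenvalue (`v ≠ 0`, `Hv = lv`, and `l ≤ l'` for every eigenpair `(l', v')`), i.e.
`l = E(H)` and `v` is a ground state. [cite: Gall2024, §2.1 (E(A) = λ₁)] -/
def IsGroundPair (terms : List (GuidedPauliTerm n)) (l : ℝ) (v : (Fin n → Bool) → ℂ) : Prop :=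
  v ≠ 0 ∧ (guidedPauliHamiltonian terms).mulVec v = (l : ℂ) • v ∧
    ∀ (l' : ℝ) (v' : (Fin n → Bool) → ℂ), v' ≠ 0 →
      (guidedPauliHamiltonian terms).mulVec v' = (l' : ℂ) • v' → l ≤ l'

/-- `HasGroundOverlap χ terms guide l v`: the guide `u` is non-zero and `(l, v)` is a ground
eigenpair with `χ² ‖u‖² ‖v‖² ≤ |⟨u, v⟩|²` — "overlap at least `χ` with the ground state of `H`"
(`‖Π u‖ ≥ χ ‖u‖`, module docstring). [cite: Gall2024, §1.3 (GLH(ε, χ), input)] -/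
def HasGroundOverlap (χ : ℝ) (terms : List (GuidedPauliTerm n))
    (guide : List (Bool × (Fin n → Bool))) (l : ℝ) (v : (Fin n → Bool) → ℂ) : Prop :=
  0 < ∑ y, ‖signedSubsetState guide y‖ ^ 2 ∧ IsGroundPair terms l v ∧
    χ ^ 2 * (∑ y, ‖signedSubsetState guide y‖ ^ 2) * (∑ y, ‖v y‖ ^ 2) ≤
      ‖∑ y, star (signedSubsetState guide y) * v y‖ ^ 2

/-! ### The two sides of Le Gall's promise, in the explicit format -/

/-- YES data of `GLH(ε, χ)` in the explicit format, precision schedule `ε = 1/g(n)`, overlap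
schedule `χ(n)`, locality `k`: `k`-local integer-weight terms, `0 < Λ`, thresholds
`a = α/(D+1)`, `b = β/(D+1)` in `[0,1]` with `b − a > 1/g(n)`, a ground eigenpair `(l, v)` with
guide overlap `≥ χ(n)`, and `E(H) = l ≤ aΛ`. [cite: Gall2024, §1.3 (GLH(ε, χ), case (i))] -/
def IsLeGallGuidedYes (k : ℕ) (g χ : ℕ → ℝ) (n : ℕ) (terms : List (GuidedPauliTerm n))
    (guide : List (Bool × (Fin n → Bool))) (α β : ℤ) (D : ℕ) : Prop :=
  IsLocalIntegral k terms ∧ 0 < pauliOneNorm terms ∧ 0 ≤ α ∧ (β : ℝ) ≤ (D : ℝ) + 1 ∧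
    ((D : ℝ) + 1) < ((β : ℝ) - α) * g n ∧
    ∃ (l : ℝ) (v : (Fin n → Bool) → ℂ), HasGroundOverlap (χ n) terms guide l v ∧
      l * ((D : ℝ) + 1) ≤ (α : ℝ) * pauliOneNorm terms

/-- NO data of `GLH(ε, χ)` in the explicit format: as `IsLeGallGuidedYes` but with
`E(H) = l > bΛ`. [cite: Gall2024, §1.3 (GLH(ε, χ), case (ii))] -/
def IsLeGallGuidedNo (k : ℕ) (g χ : ℕ → ℝ) (n : ℕ) (terms : List (GuidedPauliTerm n))
    (guide : List (Bool × (Fin n → Bool))) (α β : ℤ) (D : ℕ) : Prop :=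
  IsLocalIntegral k terms ∧ 0 < pauliOneNorm terms ∧ 0 ≤ α ∧ (β : ℝ) ≤ (D : ℝ) + 1 ∧
    ((D : ℝ) + 1) < ((β : ℝ) - α) * g n ∧
    ∃ (l : ℝ) (v : (Fin n → Bool) → ℂ), HasGroundOverlap (χ n) terms guide l v ∧
      (β : ℝ) * pauliOneNorm terms < l * ((D : ℝ) + 1)

/-- The YES instances. [cite: Gall2024, §1.3 (GLH(ε, χ))] -/
def leGallGuidedYesSet (k : ℕ) (g χ : ℕ → ℝ) : Set GuidedPauliInstance :=
  {I | ∃ (n : ℕ) (terms : List (GuidedPauliTerm n)) (guide : List (Bool × (Fin n → Bool)))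
      (α β : ℤ) (D : ℕ), I = ⟨n, (terms, (guide, (α, (β, D))))⟩ ∧
      IsLeGallGuidedYes k g χ n terms guide α β D}

/-- The NO instances. [cite: Gall2024, §1.3 (GLH(ε, χ))] -/
def leGallGuidedNoSet (k : ℕ) (g χ : ℕ → ℝ) : Set GuidedPauliInstance :=
  {I | ∃ (n : ℕ) (terms : List (GuidedPauliTerm n)) (guide : List (Bool × (Fin n → Bool)))
      (α β : ℤ) (D : ℕ), I = ⟨n, (terms, (guide, (α, (β, D))))⟩ ∧
      IsLeGallGuidedNo k g χ n terms guide α β D}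

/-- **`GLH(ε, χ)` in the explicit format**: the promise problem over `{0,1}` (same Boolean
encoding `guidedPauliEncoding` as the format's own problem) with locality `k`, precision
schedule `ε = 1/g(n)` and overlap schedule `χ(n)`. [cite: Gall2024, §1.3 (GLH(ε, χ))] -/
def leGallGuidedProblem (k : ℕ) (g χ : ℕ → ℝ) : PromiseProblem :=
  PromiseProblem.ofEncoding guidedPauliEncoding (leGallGuidedYesSet k g χ) (leGallGuidedNoSet k g χ)

/-! ### The named fact -/

/-- **Le Gall (ESA 2025): the guided local Hamiltonian problem at constant precision is in
promise-BPP, even for inverse-polynomial overlap**, specialised to the explicit format (module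
docstring: integer-weight `k`-local Pauli term lists, explicit signed subset guides, thresholds
in units of `Λ = Σ‖H_t‖`): for all constants `k` (locality), `K` (precision `ε = 1/(K+1)`) and
`c` (overlap `χ(n) = 1/(n^c + c)`), `leGallGuidedProblem k (K+1) (1/(n^c+c)) ∈ PromiseBPP'`.  As
printed: "for constant `ε`, the inclusion `GLH(ε, χ) ∈ BPP` holds for `χ = 1/poly(n)` as well"
(a consequence of Thm 4: time `poly(χ^{-k/ε}, n)`).
-- TODO(general form): Theorem 3 itself (normal `A` with an `(s, κ)`-decomposition,
-- sample-and-query ORACLE access, time `O*(s^{c' log(1/χ)/ε})`, space `O*(1/ε²)`) once the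
-- tree has an oracle model of randomised computation; `ℤ[√2]` weights via a perturbation step.
[cite: Gall2024, §1.3 (GLH(ε,χ) ∈ BPP for constant ε, χ = 1/poly) and Thm 4] -/
def LeGall2025_guidedLH_constPrecision_BPP : Prop :=
  ∀ k K c : ℕ,
    leGallGuidedProblem k (fun _ => (K : ℝ) + 1) (fun n => 1 / ((n : ℝ) ^ c + c)) ∈ PromiseBPP'

/-! ### Proved API -/

/-- An explicit instance is a YES instance iff its data satisfies `IsLeGallGuidedYes`.
[folklore] -/
theorem mk_mem_leGallGuidedYesSet_iff {k : ℕ} {g χ : ℕ → ℝ} {n : ℕ}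
    {terms : List (GuidedPauliTerm n)} {guide : List (Bool × (Fin n → Bool))} {α β : ℤ} {D : ℕ} :
    (⟨n, (terms, (guide, (α, (β, D))))⟩ : GuidedPauliInstance) ∈ leGallGuidedYesSet k g χ ↔
      IsLeGallGuidedYes k g χ n terms guide α β D := by
  refine ⟨?_, fun h => ⟨n, terms, guide, α, β, D, rfl, h⟩⟩
  rintro ⟨n', terms', guide', α', β', D', ⟨⟩, h'⟩
  exact h'

/-- An explicit instance is a NO instance iff its data satisfies `IsLeGallGuidedNo`.
[folklore] -/
theorem mk_mem_leGallGuidedNoSet_iff {k : ℕ} {g χ : ℕ → ℝ} {n : ℕ}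
    {terms : List (GuidedPauliTerm n)} {guide : List (Bool × (Fin n → Bool))} {α β : ℤ} {D : ℕ} :
    (⟨n, (terms, (guide, (α, (β, D))))⟩ : GuidedPauliInstance) ∈ leGallGuidedNoSet k g χ ↔
      IsLeGallGuidedNo k g χ n terms guide α β D := by
  refine ⟨?_, fun h => ⟨n, terms, guide, α, β, D, rfl, h⟩⟩
  rintro ⟨n', terms', guide', α', β', D', ⟨⟩, h'⟩
  exact h'

/-- Two ground eigenpairs have the same eigenvalue. [folklore] -/
theorem IsGroundPair.eigenvalue_eq {terms : List (GuidedPauliTerm n)} {l₁ l₂ : ℝ}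
    {v₁ v₂ : (Fin n → Bool) → ℂ} (h₁ : IsGroundPair terms l₁ v₁) (h₂ : IsGroundPair terms l₂ v₂) :
    l₁ = l₂ :=
  le_antisymm (h₁.2.2 l₂ v₂ h₂.1 h₂.2.1) (h₂.2.2 l₁ v₁ h₁.1 h₁.2.1)

/-- YES data and NO data are incompatible whenever `0 ≤ g n`: both sides name the least
eigenvalue `E(H)`; YES gives `E(H)(D+1) ≤ αΛ`, NO gives `βΛ < E(H)(D+1)`, and `0 < Λ` with the
gap forces `α < β`, so `αΛ < βΛ`. [folklore] -/
theorem IsLeGallGuidedYes.not_isLeGallGuidedNo {k : ℕ} {g χ : ℕ → ℝ}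
    {terms : List (GuidedPauliTerm n)} {guide : List (Bool × (Fin n → Bool))} {α β : ℤ} {D : ℕ}
    (hg : 0 ≤ g n) (hyes : IsLeGallGuidedYes k g χ n terms guide α β D) :
    ¬ IsLeGallGuidedNo k g χ n terms guide α β D := by
  rintro ⟨-, -, -, -, -, l₂, v₂, hov₂, hb⟩
  obtain ⟨-, hΛ, -, -, hgap, l₁, v₁, hov₁, ha⟩ := hyes
  have hl : l₁ = l₂ := hov₁.2.1.eigenvalue_eq hov₂.2.1
  subst hl
  have hD : (0 : ℝ) < (D : ℝ) + 1 := by positivity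
  have hβα : (0 : ℝ) < (β : ℝ) - α := by
    by_contra h
    nlinarith [mul_nonneg (neg_nonneg.2 (not_lt.1 h)) hg, hD, hgap]
  nlinarith [mul_pos hβα hΛ, ha, hb]

/-- For a non-negative precision schedule the two instance sets are disjoint. [folklore] -/
theorem disjoint_leGallGuidedYesSet_leGallGuidedNoSet (k : ℕ) {g : ℕ → ℝ} (hg : ∀ n, 0 ≤ g n)
    (χ : ℕ → ℝ) : Disjoint (leGallGuidedYesSet k g χ) (leGallGuidedNoSet k g χ) := by
  refine Set.disjoint_left.2 ?_
  rintro ⟨n, terms, guide, α, β, D⟩ hyes hno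
  rw [mk_mem_leGallGuidedYesSet_iff] at hyes
  rw [mk_mem_leGallGuidedNoSet_iff] at hno
  exact hyes.not_isLeGallGuidedNo (hg n) hno

/-- Le Gall's explicit-format problem is a disjoint promise problem for every non-negative
precision schedule. [folklore] -/
theorem leGallGuidedProblem_disjoint (k : ℕ) {g : ℕ → ℝ} (hg : ∀ n, 0 ≤ g n) (χ : ℕ → ℝ) :
    (leGallGuidedProblem k g χ).Disjoint :=
  PromiseProblem.disjoint_ofEncoding _ (disjoint_leGallGuidedYesSet_leGallGuidedNoSet k hg χ)

/-- Locality/integrality is monotone in the locality bound. [folklore] -/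
theorem IsLocalIntegral.mono {k k' : ℕ} (hk : k ≤ k') {terms : List (GuidedPauliTerm n)}
    (h : IsLocalIntegral k terms) : IsLocalIntegral k' terms :=
  fun t ht => ⟨(h t ht).1.trans hk, (h t ht).2⟩

/-- Ground-state overlap is antitone in the overlap bound. [folklore] -/
theorem HasGroundOverlap.anti {χ χ' : ℝ} (h₀ : 0 ≤ χ) (hle : χ ≤ χ')
    {terms : List (GuidedPauliTerm n)} {guide : List (Bool × (Fin n → Bool))} {l : ℝ}
    {v : (Fin n → Bool) → ℂ} (h : HasGroundOverlap χ' terms guide l v) :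
    HasGroundOverlap χ terms guide l v := by
  obtain ⟨hu, hgp, hov⟩ := h
  refine ⟨hu, hgp, le_trans ?_ hov⟩
  have hsq : χ ^ 2 ≤ χ' ^ 2 := pow_le_pow_left₀ h₀ hle 2
  have hB : 0 ≤ ∑ y, ‖v y‖ ^ 2 := Finset.sum_nonneg fun y _ => pow_nonneg (norm_nonneg _) 2
  exact mul_le_mul_of_nonneg_right (mul_le_mul_of_nonneg_right hsq hu.le) hB

/-- YES data: monotone in the locality bound, antitone in the overlap schedule. [folklore] -/
theorem IsLeGallGuidedYes.mono {k k' : ℕ} (hk : k ≤ k') {g χ χ' : ℕ → ℝ} (h₀ : 0 ≤ χ n)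
    (hle : χ n ≤ χ' n) {terms : List (GuidedPauliTerm n)} {guide : List (Bool × (Fin n → Bool))}
    {α β : ℤ} {D : ℕ} (h : IsLeGallGuidedYes k g χ' n terms guide α β D) :
    IsLeGallGuidedYes k' g χ n terms guide α β D := by
  obtain ⟨hloc, hΛ, hα, hβ, hgap, l, v, hov, ha⟩ := h
  exact ⟨hloc.mono hk, hΛ, hα, hβ, hgap, l, v, hov.anti h₀ hle, ha⟩

/-- NO data: monotone in the locality bound, antitone in the overlap schedule. [folklore] -/
theorem IsLeGallGuidedNo.mono {k k' : ℕ} (hk : k ≤ k') {g χ χ' : ℕ → ℝ} (h₀ : 0 ≤ χ n)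
    (hle : χ n ≤ χ' n) {terms : List (GuidedPauliTerm n)} {guide : List (Bool × (Fin n → Bool))}
    {α β : ℤ} {D : ℕ} (h : IsLeGallGuidedNo k g χ' n terms guide α β D) :
    IsLeGallGuidedNo k' g χ n terms guide α β D := by
  obtain ⟨hloc, hΛ, hα, hβ, hgap, l, v, hov, hb⟩ := h
  exact ⟨hloc.mono hk, hΛ, hα, hβ, hgap, l, v, hov.anti h₀ hle, hb⟩

/-- The YES set shrinks when the locality bound decreases or the overlap schedule increases.
[folklore] -/
theorem leGallGuidedYesSet_mono {k k' : ℕ} (hk : k ≤ k') {g χ χ' : ℕ → ℝ} (h₀ : ∀ n, 0 ≤ χ n)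
    (hle : ∀ n, χ n ≤ χ' n) : leGallGuidedYesSet k g χ' ⊆ leGallGuidedYesSet k' g χ := by
  rintro I ⟨n, terms, guide, α, β, D, rfl, h⟩
  exact ⟨n, terms, guide, α, β, D, rfl, h.mono hk (h₀ n) (hle n)⟩

/-- The NO set shrinks when the locality bound decreases or the overlap schedule increases.
[folklore] -/
theorem leGallGuidedNoSet_mono {k k' : ℕ} (hk : k ≤ k') {g χ χ' : ℕ → ℝ} (h₀ : ∀ n, 0 ≤ χ n)
    (hle : ∀ n, χ n ≤ χ' n) : leGallGuidedNoSet k g χ' ⊆ leGallGuidedNoSet k' g χ := by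
  rintro I ⟨n, terms, guide, α, β, D, rfl, h⟩
  exact ⟨n, terms, guide, α, β, D, rfl, h.mono hk (h₀ n) (hle n)⟩

/-- Sub-problems of Le Gall's explicit-format problem with smaller locality and larger overlap
schedule inherit membership in `PromiseBPP'`. [folklore] -/
theorem leGallGuidedProblem_mem_PromiseBPP'_mono {k k' : ℕ} (hk : k ≤ k') {g χ χ' : ℕ → ℝ}
    (h₀ : ∀ n, 0 ≤ χ n) (hle : ∀ n, χ n ≤ χ' n)
    (h : leGallGuidedProblem k' g χ ∈ PromiseBPP') : leGallGuidedProblem k g χ' ∈ PromiseBPP' := by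
  refine Literature.Computability.Cryptography.mem_PromiseBPP'_of_subset ?_ ?_ h
  · exact Computability.Encoding.toLanguage_mono _ (leGallGuidedYesSet_mono hk h₀ hle)
  · exact Computability.Encoding.toLanguage_mono _ (leGallGuidedNoSet_mono hk h₀ hle)

/-- Consequence of the fact: membership for every locality `k`, every constant precision
`1/(K+1)` and every overlap schedule `χ'` bounded below pointwise by some `1/(n^c + c)` (e.g. any
constant `χ₀ ∈ (0,1]`, taking `c ≥ 1/χ₀`; or any inverse polynomial dominating `1/(n^c + c)`).
[cite: Gall2024, §1.3 and Thm 4] -/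
theorem LeGall2025_guidedLH_constPrecision_BPP.mem_of_le
    (hLG : LeGall2025_guidedLH_constPrecision_BPP) (k K c : ℕ) {χ' : ℕ → ℝ}
    (hle : ∀ n : ℕ, 1 / ((n : ℝ) ^ c + c) ≤ χ' n) :
    leGallGuidedProblem k (fun _ => (K : ℝ) + 1) χ' ∈ PromiseBPP' :=
  leGallGuidedProblem_mem_PromiseBPP'_mono le_rfl (fun n => by positivity) hle (hLG k K c)

/-! ### Pauli decompositions of any weight (Theorem 3 with `s = 2`)

[cite: Gall2024, §5.1, problem `EV(s, χ, ε)` and Theorem 3] (held arXiv text p. 13):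

> `EV(s, χ, ε)` — Input: a normal matrix `A ∈ ℂ^{N×N}` with an `(s, κ)`-decomposition (for any
> `κ`); sample-and-query access to a quantum state `|ψ⟩ ∈ ℂᴺ` with `Γ_{A,|ψ⟩}((ε/2)κ) ≥ χ`.
> Output: an estimate `E* ∈ ℝ` such that `|E* − E(A)| ≤ εκ` holds with probability at least
> `1 − 1/exp(n)`.
> **Theorem 3.** For any `s ≥ 2` and any `ε, χ ∈ (0,1] ∩ ℝ[poly(n)]`, the problem `EV(s, χ, ε)`
> can be solved classically in time `O*(s^{c' log(1/χ)/ε})`, for some universal constant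
> `c' > 0`, and space `O*(1/ε²)`.

(`O*(·)` "suppresses the `poly(n)` factors", footnote p. 4; Def. 4: an `(s, κ)`-decomposition is
`A = Σᵢ Aᵢ` with every `Aᵢ` `s`-sparse under query access and known bounds `κᵢ ≥ ‖Aᵢ‖`,
`Σᵢ κᵢ = κ`; "for a `k`-local Hamiltonian, the decomposition (1) is precisely an
`(s, κ)`-decomposition with `s = 2^k`", and Theorem 4 = Theorem 3 with `s = 2^k`.)  A weighted
Pauli word `p_t · P_t` of ANY weight is `1`-sparse — row `x` has the single entry
`p_t · (±1, ±i)` at the column `x ⊕ (X/Y-mask of P_t)`, computable from the word — so an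
integer-weight Pauli term list on `n` qubits is a `(2, Λ)`-decomposition of `H` with `κ_t = |p_t|`,
`Λ = Σ_t |p_t|` (the format's `pauliOneNorm`), whatever the weights of its words.  With constant
`ε = 1/(K+1)` and `χ(n) = 1/(n^c + c)` (made dyadic as in the module docstring) Theorem 3 runs in
time `poly(n) · 2^{O((K+1) log(n^c + c))} = poly(n)`, and thresholding its estimate (precision
`ε/3`, whose overlap promise `Γ((ε/6)Λ) ≥ χ` is implied by overlap `≥ χ` with a ground state)
at `(a+b)Λ/2` decides the promise `E(H) ≤ aΛ` versus `E(H) > bΛ`, `b − a > ε`, with error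
`≤ 1/exp(n)`: the sentence "`GLH(ε, χ) ∈ BPP` for constant `ε` and `χ = 1/poly(n)`" therefore
holds in the explicit format WITHOUT a locality bound.  This is the reading requested by cell
pub-qadeq (unit deq-2, DEQ-A96/DEQ-A97: Jordan–Wigner placements of lattice fermions have Pauli
weight up to `n − 1` and lean on Theorem 3 with `s = 2`, not on Theorem 4); it is vendored below as
a second named fact over the SAME instance predicates (the any-weight instance sets are the unions
over `k` of the `k`-local ones — every term list on `n` qubits is `n`-local), together with the
proof that it implies the `k`-local fact.
-/

/-- YES instances of `GLH(ε, χ)` in the explicit format with NO locality bound: the union over `k`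
of the `k`-local YES sets (integer-weight Pauli term lists of any weight).
[cite: Gall2024, §5.1 `EV(s, χ, ε)` with Def. 4 (`s = 2`: Pauli words are `1`-sparse)] -/
def leGallGuidedYesSetAnyWeight (g χ : ℕ → ℝ) : Set GuidedPauliInstance :=
  ⋃ k, leGallGuidedYesSet k g χ

/-- NO instances of `GLH(ε, χ)` in the explicit format with NO locality bound.
[cite: Gall2024, §5.1 `EV(s, χ, ε)` with Def. 4 (`s = 2`)] -/
def leGallGuidedNoSetAnyWeight (g χ : ℕ → ℝ) : Set GuidedPauliInstance :=
  ⋃ k, leGallGuidedNoSet k g χ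

/-- **`GLH(ε, χ)` in the explicit format, Pauli terms of any weight** (precision schedule
`ε = 1/g(n)`, overlap schedule `χ(n)`). [cite: Gall2024, §1.3 (GLH(ε, χ)) read through §5.1
Theorem 3 with `s = 2`] -/
def leGallGuidedProblemAnyWeight (g χ : ℕ → ℝ) : PromiseProblem :=
  PromiseProblem.ofEncoding guidedPauliEncoding (leGallGuidedYesSetAnyWeight g χ)
    (leGallGuidedNoSetAnyWeight g χ)

/-- **Le Gall (ESA 2025), Theorem 3 with `s = 2`: the guided Hamiltonian problem for
integer-weight Pauli term lists of ANY weight, at constant precision and inverse-polynomial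
overlap, is in promise-BPP**: for all constants `K` (precision `ε = 1/(K+1)`) and `c` (overlap
`χ(n) = 1/(n^c + c)`), `leGallGuidedProblemAnyWeight (K+1) (1/(n^c+c)) ∈ PromiseBPP'`.  A Pauli
term list is a `(2, Λ)`-decomposition of `H` (Def. 4), so Theorem 3 estimates `E(H)` to `εΛ/3` in
time `O*(2^{3c' log(1/χ)/ε}) = poly(n)` with probability `≥ 1 − 1/exp(n)`, and thresholding at
`(a+b)Λ/2` decides the promise (section docstring).  Implies the `k`-local fact
(`LeGall2025_guidedPauliAnyWeight_constPrecision_BPP.toLocal`).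
-- TODO(general form): Theorem 3 itself (arbitrary `s`, oracle access, the time bound as a
-- function of `s, χ, ε`) once the tree has an oracle model of randomised computation.
[cite: Gall2024, §5.1 Thm 3 (with `s = 2`, constant `ε`, `χ = 1/poly(n)`), Def. 4, and §1.3
(the `GLH(ε, χ) ∈ BPP` sentence)] -/
def LeGall2025_guidedPauliAnyWeight_constPrecision_BPP : Prop :=
  ∀ K c : ℕ,
    leGallGuidedProblemAnyWeight (fun _ => (K : ℝ) + 1) (fun n => 1 / ((n : ℝ) ^ c + c)) ∈
      PromiseBPP'

/-! #### Proved API for the any-weight problem -/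

/-- Every `k`-local YES instance is an any-weight YES instance. [cite: Gall2024, §2.3 with Def. 4
(a `k`-local term list is in particular a `(2^k, κ)`-, here `(2, Λ)`-, decomposition)] -/
theorem leGallGuidedYesSet_subset_anyWeight (k : ℕ) (g χ : ℕ → ℝ) :
    leGallGuidedYesSet k g χ ⊆ leGallGuidedYesSetAnyWeight g χ :=
  Set.subset_iUnion (fun k => leGallGuidedYesSet k g χ) k

/-- Every `k`-local NO instance is an any-weight NO instance. [cite: Gall2024, §2.3 with Def. 4] -/
theorem leGallGuidedNoSet_subset_anyWeight (k : ℕ) (g χ : ℕ → ℝ) :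
    leGallGuidedNoSet k g χ ⊆ leGallGuidedNoSetAnyWeight g χ :=
  Set.subset_iUnion (fun k => leGallGuidedNoSet k g χ) k

/-- Conversely every any-weight instance on `n` qubits is `n`-local: the any-weight YES set is
exhausted by the `k`-local ones with `k` the instance's own qubit count. [cite: Gall2024, §2.3
("each term `H_i` … acting non-trivially on at most `k` qubits", `k ≤ n`)] -/
theorem mem_leGallGuidedYesSetAnyWeight_iff {g χ : ℕ → ℝ} {I : GuidedPauliInstance} :
    I ∈ leGallGuidedYesSetAnyWeight g χ ↔ ∃ k, I ∈ leGallGuidedYesSet k g χ :=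
  Set.mem_iUnion

/-- YES data at locality `k` and NO data at locality `k'` are incompatible whenever `0 ≤ g n`
(the incompatibility argument of `IsLeGallGuidedYes.not_isLeGallGuidedNo` never uses locality:
both sides name the least eigenvalue). [cite: Gall2024, §1.3 (GLH(ε, χ): "Promise: (i) `E(H) ≤ a`
or (ii) `E(H) > b`" with `b − a > ε` — the two cases are exclusive)] -/
theorem IsLeGallGuidedYes.not_isLeGallGuidedNo' {k k' : ℕ} {g χ : ℕ → ℝ}
    {terms : List (GuidedPauliTerm n)} {guide : List (Bool × (Fin n → Bool))} {α β : ℤ} {D : ℕ}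
    (hg : 0 ≤ g n) (hyes : IsLeGallGuidedYes k g χ n terms guide α β D) :
    ¬ IsLeGallGuidedNo k' g χ n terms guide α β D := by
  rintro ⟨-, -, -, -, -, l₂, v₂, hov₂, hb⟩
  obtain ⟨-, hΛ, -, -, hgap, l₁, v₁, hov₁, ha⟩ := hyes
  have hl : l₁ = l₂ := hov₁.2.1.eigenvalue_eq hov₂.2.1
  subst hl
  have hD : (0 : ℝ) < (D : ℝ) + 1 := by positivity
  have hβα : (0 : ℝ) < (β : ℝ) - α := by
    by_contra h
    nlinarith [mul_nonneg (neg_nonneg.2 (not_lt.1 h)) hg, hD, hgap]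
  nlinarith [mul_pos hβα hΛ, ha, hb]

/-- For a non-negative precision schedule the any-weight instance sets are disjoint.
[cite: Gall2024, §1.3 (GLH(ε, χ), exclusive promises (i)/(ii))] -/
theorem disjoint_leGallGuidedYesSetAnyWeight_NoSetAnyWeight {g : ℕ → ℝ} (hg : ∀ n, 0 ≤ g n)
    (χ : ℕ → ℝ) : Disjoint (leGallGuidedYesSetAnyWeight g χ) (leGallGuidedNoSetAnyWeight g χ) := by
  refine Set.disjoint_left.2 ?_
  rintro ⟨n, terms, guide, α, β, D⟩ hyes hno
  obtain ⟨k, hk⟩ := Set.mem_iUnion.1 hyes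
  obtain ⟨k', hk'⟩ := Set.mem_iUnion.1 hno
  rw [mk_mem_leGallGuidedYesSet_iff] at hk
  rw [mk_mem_leGallGuidedNoSet_iff] at hk'
  exact hk.not_isLeGallGuidedNo' (hg n) hk'

/-- The any-weight problem is a disjoint promise problem for every non-negative precision
schedule. [cite: Gall2024, §1.3 (GLH(ε, χ) is a promise problem)] -/
theorem leGallGuidedProblemAnyWeight_disjoint {g : ℕ → ℝ} (hg : ∀ n, 0 ≤ g n) (χ : ℕ → ℝ) :
    (leGallGuidedProblemAnyWeight g χ).Disjoint :=
  PromiseProblem.disjoint_ofEncoding _ (disjoint_leGallGuidedYesSetAnyWeight_NoSetAnyWeight hg χ)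

/-- The any-weight sets are antitone in the overlap schedule (a guide with overlap `≥ χ'` has
overlap `≥ χ` for `χ ≤ χ'`). [cite: Gall2024, §1.3 (GLH(ε, χ), input "overlap at least `χ`")] -/
theorem leGallGuidedYesSetAnyWeight_mono {g χ χ' : ℕ → ℝ} (h₀ : ∀ n, 0 ≤ χ n)
    (hle : ∀ n, χ n ≤ χ' n) : leGallGuidedYesSetAnyWeight g χ' ⊆ leGallGuidedYesSetAnyWeight g χ :=
  Set.iUnion_mono fun _ => leGallGuidedYesSet_mono le_rfl h₀ hle

/-- The any-weight NO sets are antitone in the overlap schedule. [cite: Gall2024, §1.3 (GLH(ε, χ),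
input "overlap at least `χ`")] -/
theorem leGallGuidedNoSetAnyWeight_mono {g χ χ' : ℕ → ℝ} (h₀ : ∀ n, 0 ≤ χ n)
    (hle : ∀ n, χ n ≤ χ' n) : leGallGuidedNoSetAnyWeight g χ' ⊆ leGallGuidedNoSetAnyWeight g χ :=
  Set.iUnion_mono fun _ => leGallGuidedNoSet_mono le_rfl h₀ hle

/-- Membership of the any-weight problem in `PromiseBPP'` descends to every `k`-local sub-problem
(promise-BPP is antitone in the promise). [cite: Gall2024, §5.2, proof of Thm 4 ("We apply
Theorem 3 with `A = H`, `s = 2^k`")] -/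
theorem leGallGuidedProblem_mem_PromiseBPP'_of_anyWeight (k : ℕ) {g χ : ℕ → ℝ}
    (h : leGallGuidedProblemAnyWeight g χ ∈ PromiseBPP') : leGallGuidedProblem k g χ ∈ PromiseBPP' := by
  refine Literature.Computability.Cryptography.mem_PromiseBPP'_of_subset ?_ ?_ h
  · exact Computability.Encoding.toLanguage_mono _ (leGallGuidedYesSet_subset_anyWeight k g χ)
  · exact Computability.Encoding.toLanguage_mono _ (leGallGuidedNoSet_subset_anyWeight k g χ)

/-- Membership of the any-weight problem is inherited by larger overlap schedules.
[cite: Gall2024, §1.3 ("the inclusion `GLH(ε, χ) ∈ BPP` holds for `χ = 1/poly(n)` as well")] -/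
theorem leGallGuidedProblemAnyWeight_mem_PromiseBPP'_mono {g χ χ' : ℕ → ℝ} (h₀ : ∀ n, 0 ≤ χ n)
    (hle : ∀ n, χ n ≤ χ' n) (h : leGallGuidedProblemAnyWeight g χ ∈ PromiseBPP') :
    leGallGuidedProblemAnyWeight g χ' ∈ PromiseBPP' := by
  refine Literature.Computability.Cryptography.mem_PromiseBPP'_of_subset ?_ ?_ h
  · exact Computability.Encoding.toLanguage_mono _ (leGallGuidedYesSetAnyWeight_mono h₀ hle)
  · exact Computability.Encoding.toLanguage_mono _ (leGallGuidedNoSetAnyWeight_mono h₀ hle)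

/-- **The any-weight fact implies the `k`-local fact** (`LeGall2025_guidedLH_constPrecision_BPP`):
Theorem 4 is Theorem 3 specialised, and in the explicit format every `k`-local instance is an
any-weight instance. [cite: Gall2024, §5.2, proof of Thm 4 ("We apply Theorem 3 with `A = H`,
`s = 2^k`")] -/
theorem LeGall2025_guidedPauliAnyWeight_constPrecision_BPP.toLocal
    (h : LeGall2025_guidedPauliAnyWeight_constPrecision_BPP) :
    LeGall2025_guidedLH_constPrecision_BPP :=
  fun k K c => leGallGuidedProblem_mem_PromiseBPP'_of_anyWeight k (h K c)

/-- Consequence of the any-weight fact: membership for every constant precision `1/(K+1)` and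
every overlap schedule bounded below pointwise by some `1/(n^c + c)`. [cite: Gall2024, §5.1
Thm 3 (with `s = 2`)] -/
theorem LeGall2025_guidedPauliAnyWeight_constPrecision_BPP.mem_of_le
    (h : LeGall2025_guidedPauliAnyWeight_constPrecision_BPP) (K c : ℕ) {χ' : ℕ → ℝ}
    (hle : ∀ n : ℕ, 1 / ((n : ℝ) ^ c + c) ≤ χ' n) :
    leGallGuidedProblemAnyWeight (fun _ => (K : ℝ) + 1) χ' ∈ PromiseBPP' :=
  leGallGuidedProblemAnyWeight_mem_PromiseBPP'_mono (fun n => by positivity) hle (h K c)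

end Literature.Computability.QuantumComplexity
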